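import Mathlib
import HarnessLib
import Summits.NavierStokesRegularity.NavierStokesRegularity.Theorems.PoloidalWindowDoorLrcModEntireTHCert

/-!
# Route `PoloidalWindowDoor`, item `LrcModEntire` (stmt-NavierStokesRegularity-20428) — CHEAP LITERAL ENCODING for large certificate polynomials

Cell ns-regularity-ideate, seat ns-poloidal-K2-p3 gen 7 (lead of item 20428; `--supports stmt-NavierStokesRegularity-20428`; definitions reviewed).
Measured on the farm (work/THCertBigLit*.lean): a 3000-term polynomial written with `…THCert.mkPoly` (`([(i,e),…], (c : ℤ), d)` triples) does not
even ELABORATE within the default 200 000 heartbeats (numeral/coercion instances per term); written as rows of natural numbers it elaborates, but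
ONE 3000-row list literal times out in the code generator (LCNF) — so `native_decide` cannot run; split into slices of ≤ 300 rows joined by `++`
the whole file (elaborate + compile + `native_decide` of a merge-sort normalisation of the 3000 terms over 70 letters) takes 17.6 s.  Hence the
encoding of record for engine exports with large laws / cofactors:

* `pairUp [i₁, e₁, i₂, e₂, …] = [(i₁,e₁), (i₂,e₂), …]`;
* `decodeTerm n [sgn, num, den, i₁, e₁, …]` = the term `(denseExp n [(i₁,e₁),…], ±num/den)` (`sgn = 0` ⇒ `+`, else `−`);
* `decodePoly n rows` = the term list — the same `QMvPoly` data `mkPoly` would build, so every checker / closer applies unchanged (the certified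
  laws `Tᵢ`, the cofactors and the split / cancel polynomials are plain `QMvPoly` arguments).
`cert2lean.py` (HOME/ns-poloidal-K2-p3/g7/py/) emits `decodePoly n (rows₀ ++ rows₁ ++ …)` with ≤ 250-row slice definitions for every polynomial
above 120 terms.  WHAT THIS IS NOT: not a claim about Navier–Stokes — data plumbing (bears_on LADDER-NS N0, item 20428). [folklore]
-/

-- the summit and its single sub-problem share the name (CONVENTIONS §1), as in every Theorems file
set_option linter.dupNamespace false

namespace Summit.NavierStokesRegularity.NavierStokesRegularity.Theorems.PoloidalWindowDoorLrcModEntireTHCertDecode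

open Literature.Analysis.ValidatedNumerics
open Summit.NavierStokesRegularity.NavierStokesRegularity.Theorems.PoloidalWindowDoorLrcModEntireTHCert

/-- Pairs up a flat list: `[i₁, e₁, i₂, e₂, …] ↦ [(i₁,e₁), (i₂,e₂), …]` (a trailing singleton is dropped). [folklore] -/
def pairUp : List ℕ → List (ℕ × ℕ)
  | i :: e :: rest => (i, e) :: pairUp rest
  | _ => []

/-- Decodes one term row `[sgn, num, den, i₁, e₁, i₂, e₂, …]`: exponent vector `denseExp n [(i₁,e₁),…]`, coefficient `±num/den`
(`sgn = 0` ⇒ `+`, otherwise `−`); a malformed row decodes to the zero constant term. [folklore] -/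
def decodeTerm (n : ℕ) : List ℕ → List ℕ × ℚ
  | sgn :: num :: den :: rest => (denseExp n (pairUp rest), (if sgn = 0 then (num : ℚ) else -(num : ℚ)) / (den : ℚ))
  | _ => (denseExp n [], 0)

/-- Decodes a polynomial (term list) from natural-number rows. [folklore] -/
def decodePoly (n : ℕ) (rows : List (List ℕ)) : QMvPoly := rows.map (decodeTerm n)

/-- Self-test: the row encoding of `R2 = w_zz + μ(w_xx + w_yy)` over the 25 smoke-test letters decodes to the `mkPoly` form. [folklore] -/
theorem decodePoly_example :
    decodePoly 25 [[0, 1, 1, 13, 1, 18, 1], [0, 1, 1, 14, 1, 18, 1], [0, 1, 1, 15, 1]] =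
      mkPoly 25 [([(13, 1), (18, 1)], (1 : ℤ), 1), ([(14, 1), (18, 1)], (1 : ℤ), 1), ([(15, 1)], (1 : ℤ), 1)] := by
  decide +kernel

end Summit.NavierStokesRegularity.NavierStokesRegularity.Theorems.PoloidalWindowDoorLrcModEntireTHCertDecode
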